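import Summits.AtomisticToContinuum.HydrodynamicLimit.Theorems.InformationPercolationEngineChaosClosesEulerReductionEuler
import Summits.AtomisticToContinuum.HydrodynamicLimit.Theorems.InformationPercolationEngineChaosClosesEulerReductionFields
import HarnessLib

/-!
# Kinetic reduction (crux `ChaosClosesEuler`, stmt-AtomisticToContinuum-15141, line `Sketch`,
# stub `stub_kineticReduction`) — helper: space–time integrals along one orbit, and the transport algebra

WHAT. Bookkeeping for the momentum residual (H2) and the entropy functional (H3) of the BF18 shell along ONE good
orbit:

* `spaceTime_bounds` — KINETIC DOMINATION: an integrand `F(s, x)` measurable on the strip `[a, b] × 𝕋³`, with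
  measurable sections and `|F(s, x)| ≤ C₁ + C₂ e_r(s, x) + C₃ ρ_r(s, x)` (cone fields of the orbit at time `s`), is
  integrable in `x` at every instant with `|∫ₓ F(s)| ≤ C₁ + C₂ ke + C₃` (unit mass, conserved energy `ke`), the profile
  `s ↦ ∫ₓ F(s)` is integrable on `[a, b]`, and `|∫_{[a,b]} ∫ₓ F| ≤ (b − a)(C₁ + C₂ ke + C₃)` — every constant being
  independent of the mollification radius `r`;
* `transport_pointwise` — the algebra of the kinetic flux: `∑ Dᵢⱼ Mᵢⱼ = ∑ Dᵢⱼ (mᵢmⱼ/ρ + δᵢⱼ p) + ∑ Aᵢⱼ Pᵢⱼ + (tr D)(ρθ − p)`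
  with `A = D − (tr D/3)𝟙` traceless and `P = M − m⊗m/ρ` the central tensor (`tr P = 3ρθ` identically), for every
  matrix `D` and scalar `p`.

No named fact is invoked.
-/

noncomputable section

namespace Summit.AtomisticToContinuum.HydrodynamicLimit.Theorems.ChaosClosesEulerReduction

open scoped BigOperators Topology Classical MeasureTheory ENNReal InnerProductSpace
open Filter Set MeasureTheory Function
open Literature.MathematicalPhysics.KineticTheory
open Literature.Analysis.FluidPDE
open Literature.Analysis.FunctionSpaces
open Summit.AtomisticToContinuum.HydrodynamicLimit.Theorems.LocalSecondLawNegative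
open Summit.AtomisticToContinuum.HydrodynamicLimit.Theorems.LocalSecondLawLedger
open Summit.AtomisticToContinuum.HydrodynamicLimit.Theorems.LocalSecondLawLedger.L (Mmom Mmom_symm norm_sq_eq_sum)

variable {N : ℕ}

/-! ## §1 Kinetic domination of space–time integrals along one orbit -/

/-- The integral of a constant over `𝕋³` (unit volume). [folklore] -/
theorem integral_const_T3 (c : ℝ) : ∫ _ : T3, c = c := by simp

/-- **Kinetic domination.** Along a good orbit, an integrand on the strip `[a, b] × 𝕋³` that is measurable on the
strip, has measurable sections, and is dominated by `C₁ + C₂ e_r + C₃ ρ_r` (cone fields of the orbit), has: integrable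
sections with `|∫ₓ F(s)| ≤ C₁ + C₂ ke + C₃`; an integrable time profile; `|∫_{[a,b]}∫ₓ F| ≤ (b − a)(C₁ + C₂ ke + C₃)`.
[folklore] -/
theorem spaceTime_bounds {σ : ℝ} (Φ : HardSphereFlow (Torus.geometry (Fin 3)) (hsDiameter σ N) (N + 1))
    {z : Phase N} (hz : z ∈ Φ.good) {r : ℝ} (hr : 0 < r) (hr2 : r < 1 / 2) {a b : ℝ} (hab : a ≤ b)
    {F : ℝ → T3 → ℝ} (hF1 : AEStronglyMeasurable (uncurry F) ((volume.restrict (Icc a b)).prod volume))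
    (hF2 : ∀ s ∈ Icc a b, AEStronglyMeasurable (F s) volume)
    {C₁ C₂ C₃ : ℝ} (hC₂ : 0 ≤ C₂) (hC₃ : 0 ≤ C₃)
    (hFb : ∀ s ∈ Icc a b, ∀ x, |F s x| ≤ C₁ + C₂ * kinC r (Φ.flow s z) x + C₃ * rhoC r (Φ.flow s z) x) :
    (∀ s ∈ Icc a b, Integrable (F s) volume) ∧
    (∀ s ∈ Icc a b, |∫ x, F s x| ≤ C₁ + C₂ * ke z + C₃) ∧
    IntegrableOn (fun s => ∫ x, F s x) (Icc a b) volume ∧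
    |∫ s in Icc a b, ∫ x, F s x| ≤ (b - a) * (C₁ + C₂ * ke z + C₃) := by
  have hke : ∀ s, ke (Φ.flow s z) = ke z := fun s => ke_flow_eq Φ hz s
  have hke0 : 0 ≤ ke z := ke_nonneg z
  -- the dominating profile at time `s`
  have hdomc : ∀ s, Continuous fun x => C₁ + C₂ * kinC r (Φ.flow s z) x + C₃ * rhoC r (Φ.flow s z) x := fun s =>
    (continuous_const.add (continuous_const.mul (continuous_kinC r _))).add
      (continuous_const.mul (KineticClosureDensity.continuous_mollDensity r _))
  have hdomi : ∀ s, Integrable (fun x => C₁ + C₂ * kinC r (Φ.flow s z) x + C₃ * rhoC r (Φ.flow s z) x) volume :=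
    fun s => (hdomc s).integrable_unitAddTorus
  have hdomI : ∀ s, ∫ x, (C₁ + C₂ * kinC r (Φ.flow s z) x + C₃ * rhoC r (Φ.flow s z) x) = C₁ + C₂ * ke z + C₃ := by
    intro s
    have hA1 : Integrable (fun _ : T3 => C₁) volume := integrable_const _
    have hA2 : Integrable (fun x => C₂ * kinC r (Φ.flow s z) x) volume :=
      (continuous_kinC r _).integrable_unitAddTorus.const_mul C₂
    have hA : Integrable (fun x => C₁ + C₂ * kinC r (Φ.flow s z) x) volume := hA1.add hA2
    have hB : Integrable (fun x => C₃ * rhoC r (Φ.flow s z) x) volume :=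
      (KineticClosureDensity.continuous_mollDensity r _).integrable_unitAddTorus.const_mul C₃
    have e1 := integral_add hA hB
    have e2 := integral_add hA1 hA2
    have h1 : ∫ x, rhoC r (Φ.flow s z) x = 1 := integral_rhoC_eq_one hr hr2 _
    rw [e1, e2, integral_const_T3, integral_const_mul, integral_const_mul, integral_kinC_eq_ke hr hr2, hke s, h1, mul_one]
  -- sections
  have hsec : ∀ s ∈ Icc a b, Integrable (F s) volume := fun s hs =>
    Integrable.mono' (hdomi s) (hF2 s hs) (ae_of_all _ fun x => by rw [Real.norm_eq_abs]; exact hFb s hs x)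
  have hsecb : ∀ s ∈ Icc a b, |∫ x, F s x| ≤ C₁ + C₂ * ke z + C₃ := by
    intro s hs
    rw [← hdomI s, ← Real.norm_eq_abs]
    exact norm_integral_le_of_norm_le (hdomi s) (ae_of_all _ fun x => by rw [Real.norm_eq_abs]; exact hFb s hs x)
  -- the time profile: bounded (an `r`-dependent bound is enough) and Fubini-measurable
  have hpeak : ∀ s ∈ Icc a b, ∀ x, ‖F s x‖ ≤ C₁ + C₂ * (3 / (Real.pi * r ^ 3) * ke z) + C₃ * (3 / (Real.pi * r ^ 3)) := by
    intro s hs x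
    rw [Real.norm_eq_abs]
    refine (hFb s hs x).trans ?_
    have h1 : kinC r (Φ.flow s z) x ≤ 3 / (Real.pi * r ^ 3) * ke z := by rw [← hke s]; exact psvK_kinC_le hr _ _
    have h2 : rhoC r (Φ.flow s z) x ≤ 3 / (Real.pi * r ^ 3) := rhoC_le hr _ _
    gcongr
  have hprof : IntegrableOn (fun s => ∫ x, F s x) (Icc a b) volume :=
    ChaosClosesEulerReadout.integrableOn_integral_of_bdd hF1 hpeak
  refine ⟨hsec, hsecb, hprof, ?_⟩
  have h := norm_setIntegral_le_of_norm_le_const (μ := (volume : Measure ℝ)) (s := Icc a b) (f := fun s => ∫ x, F s x)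
    measure_Icc_lt_top (fun s hs => by rw [Real.norm_eq_abs]; exact hsecb s hs)
  rw [Real.norm_eq_abs, measureReal_def, Real.volume_Icc, ENNReal.toReal_ofReal (by linarith)] at h
  linarith [h]

/-- Splitting a time integral at an intermediate time: `∫_{[0,τ]} = ∫_{[0,τ']} + ∫_{(τ',τ]}` for a profile integrable
on `[0, τ]`, `0 ≤ τ' ≤ τ`. [folklore] -/
theorem setIntegral_Icc_split {f : ℝ → ℝ} {τ' τ : ℝ} (h0 : 0 ≤ τ') (hτ : τ' ≤ τ) (hf : IntegrableOn f (Icc 0 τ) volume) :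
    ∫ s in Icc 0 τ, f s = (∫ s in Icc 0 τ', f s) + ∫ s in Ioc τ' τ, f s := by
  rw [← Set.Icc_union_Ioc_eq_Icc h0 hτ, setIntegral_union ((Set.Iic_disjoint_Ioc le_rfl).mono_left Set.Icc_subset_Iic_self)
    measurableSet_Ioc
    (hf.mono_set (Set.Icc_subset_Icc_right hτ)) (hf.mono_set (Set.Ioc_subset_Icc_self.trans (Set.Icc_subset_Icc_left h0)))]

/-- The window piece of a kinetically dominated profile: `|∫_{(τ',τ]}∫ₓ F| ≤ (τ − τ')(C₁ + C₂ ke + C₃)`. [folklore] -/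
theorem abs_setIntegral_Ioc_le {z : Phase N} {a b τ' τ : ℝ} (hτ' : a ≤ τ') (hτ : τ' ≤ τ) (hτb : τ ≤ b)
    {F : ℝ → T3 → ℝ} {C₁ C₂ C₃ : ℝ} (hsecb : ∀ s ∈ Icc a b, |∫ x, F s x| ≤ C₁ + C₂ * ke z + C₃) :
    |∫ s in Ioc τ' τ, ∫ x, F s x| ≤ (τ - τ') * (C₁ + C₂ * ke z + C₃) := by
  have h := norm_setIntegral_le_of_norm_le_const (μ := (volume : Measure ℝ)) (s := Ioc τ' τ) (f := fun s => ∫ x, F s x)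
    measure_Ioc_lt_top (fun s hs => by
      rw [Real.norm_eq_abs]; exact hsecb s ⟨hτ'.trans hs.1.le, hs.2.trans hτb⟩)
  rw [Real.norm_eq_abs, measureReal_def, Real.volume_Ioc, ENNReal.toReal_ofReal (by linarith)] at h
  linarith [h]

/-! ## §2 Pointwise bounds of the cone tensors -/

/-- `|M_{ij}| ≤ 2 e_r`. [folklore] -/
theorem abs_Mmom_le {r : ℝ} (hr : 0 < r) (w : Phase N) (x : T3) (i j : Fin 3) : |Mmom r w x i j| ≤ 2 * kinC r w x := by
  unfold Mmom
  rw [kinC_eq_sum, abs_mul, abs_of_nonneg (by positivity), ← mul_assoc, mul_comm (2 : ℝ), mul_assoc, Finset.mul_sum]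
  refine mul_le_mul_of_nonneg_left ((Finset.abs_sum_le_sum_abs _ _).trans (Finset.sum_le_sum fun p _ => ?_)) (by positivity)
  rw [abs_mul, abs_of_nonneg (cone_nonneg hr _ _)]
  have h1 : |(w p).2 i * (w p).2 j| ≤ ‖(w p).2‖ ^ 2 := by
    rw [abs_mul, norm_sq_eq_sum, Fin.sum_univ_three]
    have hi : |(w p).2 i| ^ 2 ≤ (w p).2 0 ^ 2 + (w p).2 1 ^ 2 + (w p).2 2 ^ 2 := by
      rw [sq_abs]; fin_cases i <;> simp <;> nlinarith [sq_nonneg ((w p).2 0), sq_nonneg ((w p).2 1), sq_nonneg ((w p).2 2)]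
    have hj : |(w p).2 j| ^ 2 ≤ (w p).2 0 ^ 2 + (w p).2 1 ^ 2 + (w p).2 2 ^ 2 := by
      rw [sq_abs]; fin_cases j <;> simp <;> nlinarith [sq_nonneg ((w p).2 0), sq_nonneg ((w p).2 1), sq_nonneg ((w p).2 2)]
    nlinarith [abs_nonneg ((w p).2 i), abs_nonneg ((w p).2 j), sq_nonneg (|(w p).2 i| - |(w p).2 j|)]
  calc cone r (w p).1 x * |(w p).2 i * (w p).2 j| ≤ cone r (w p).1 x * ‖(w p).2‖ ^ 2 :=
        mul_le_mul_of_nonneg_left h1 (cone_nonneg hr _ _)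
    _ = 2 * (cone r (w p).1 x * (‖(w p).2‖ ^ 2 / 2)) := by ring

/-- `‖m_r‖ ≤ ρ_r/2 + e_r`. [folklore] -/
theorem norm_momC_le_half {r : ℝ} (hr : 0 < r) (w : Phase N) (x : T3) : ‖momC r w x‖ ≤ rhoC r w x / 2 + kinC r w x := by
  have h := norm_momC_sq_le hr w x
  have hρ := rhoC_nonneg hr w x
  have hk := kinC_nonneg hr w x
  nlinarith [sq_nonneg (‖momC r w x‖ - rhoC r w x / 2 - kinC r w x), norm_nonneg (momC r w x),
    sq_nonneg (rhoC r w x / 2 - kinC r w x)]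

/-- A double sum of `3 × 3` terms each bounded by `C` is bounded by `9C`. [folklore] -/
theorem abs_sum_sum_le {f : Fin 3 → Fin 3 → ℝ} {C : ℝ} (h : ∀ i j, |f i j| ≤ C) : |∑ i : Fin 3, ∑ j : Fin 3, f i j| ≤ 9 * C := by
  calc _ ≤ ∑ i : Fin 3, ∑ j : Fin 3, |f i j| := (Finset.abs_sum_le_sum_abs _ _).trans
        (Finset.sum_le_sum fun i _ => Finset.abs_sum_le_sum_abs _ _)
    _ ≤ ∑ _i : Fin 3, ∑ _j : Fin 3, C := Finset.sum_le_sum fun i _ => Finset.sum_le_sum fun j _ => h i j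
    _ = 9 * C := by simp [Finset.sum_const, Finset.card_univ]; ring

/-- Weighted form: `|∑ᵢⱼ Dᵢⱼ Xᵢⱼ| ≤ C_D ∑ᵢⱼ |Xᵢⱼ|` when `|Dᵢⱼ| ≤ C_D`. [folklore] -/
theorem abs_sum_sum_mul_le {D X : Fin 3 → Fin 3 → ℝ} {CD : ℝ} (hD : ∀ i j, |D i j| ≤ CD) :
    |∑ i : Fin 3, ∑ j : Fin 3, D i j * X i j| ≤ CD * ∑ i : Fin 3, ∑ j : Fin 3, |X i j| := by
  rw [Finset.mul_sum]
  refine (Finset.abs_sum_le_sum_abs _ _).trans (Finset.sum_le_sum fun i _ => ?_)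
  rw [Finset.mul_sum]
  refine (Finset.abs_sum_le_sum_abs _ _).trans (Finset.sum_le_sum fun j _ => ?_)
  rw [abs_mul]
  exact mul_le_mul_of_nonneg_right (hD i j) (abs_nonneg _)

/-! ## §3 The transport algebra -/

/-- A diagonal double sum. [folklore] -/
theorem sum_sum_ite_eq_mul (c : ℝ) (X : Fin 3 → Fin 3 → ℝ) :
    ∑ i : Fin 3, ∑ j : Fin 3, (if i = j then c else 0) * X i j = c * ∑ k : Fin 3, X k k := by
  rw [Finset.mul_sum]
  refine Finset.sum_congr rfl fun i _ => ?_
  rw [Finset.sum_eq_single i (fun j _ hji => by rw [if_neg (Ne.symm hji), zero_mul]) (fun h => absurd (Finset.mem_univ i) h),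
    if_pos rfl]

/-- **The transport algebra, pointwise.** For every matrix `D` and scalar `p`:
`∑ Dᵢⱼ Mᵢⱼ = ∑ Dᵢⱼ (mᵢmⱼ/ρ_r + δᵢⱼ p) + ∑ (Dᵢⱼ − δᵢⱼ tr D/3)(Mᵢⱼ − mᵢmⱼ/ρ_r) + (tr D)(ρ_rθ_r − p)`
(the central tensor has trace `3ρ_rθ_r` identically). [folklore] -/
theorem transport_pointwise {r : ℝ} (hr : 0 < r) (w : Phase N) (x : T3) (D : Fin 3 → Fin 3 → ℝ) (p : ℝ) :
    ∑ i : Fin 3, ∑ j : Fin 3, D i j * Mmom r w x i j =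
      (∑ i : Fin 3, ∑ j : Fin 3, D i j * (momC r w x i * momC r w x j / rhoC r w x + if i = j then p else 0)) +
      (∑ i : Fin 3, ∑ j : Fin 3, (D i j - if i = j then (∑ k : Fin 3, D k k) / 3 else 0) *
        (Mmom r w x i j - momC r w x i * momC r w x j / rhoC r w x)) +
      (∑ k : Fin 3, D k k) * (rhoC r w x * thetaC r w x - p) := by
  have htr := trace_Pm hr w x
  -- expand the middle sum
  have hmid : ∑ i : Fin 3, ∑ j : Fin 3, (D i j - if i = j then (∑ k : Fin 3, D k k) / 3 else 0) *
      (Mmom r w x i j - momC r w x i * momC r w x j / rhoC r w x) =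
      (∑ i : Fin 3, ∑ j : Fin 3, D i j * (Mmom r w x i j - momC r w x i * momC r w x j / rhoC r w x)) -
        (∑ k : Fin 3, D k k) / 3 * (3 * (rhoC r w x * thetaC r w x)) := by
    rw [← htr]
    have hdiag : ∑ i : Fin 3, ∑ j : Fin 3, (if i = j then (∑ k : Fin 3, D k k) / 3 else 0) *
        (Mmom r w x i j - momC r w x i * momC r w x j / rhoC r w x) =
        (∑ k : Fin 3, D k k) / 3 * ∑ k : Fin 3, (Mmom r w x k k - momC r w x k * momC r w x k / rhoC r w x) :=
      sum_sum_ite_eq_mul _ _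
    rw [← hdiag, ← Finset.sum_sub_distrib]
    refine Finset.sum_congr rfl fun i _ => ?_
    rw [← Finset.sum_sub_distrib]
    refine Finset.sum_congr rfl fun j _ => by ring
  -- expand the first sum
  have hfirst : ∑ i : Fin 3, ∑ j : Fin 3, D i j * (momC r w x i * momC r w x j / rhoC r w x + if i = j then p else 0) =
      (∑ i : Fin 3, ∑ j : Fin 3, D i j * (momC r w x i * momC r w x j / rhoC r w x)) + (∑ k : Fin 3, D k k) * p := by
    have h2 : ∑ i : Fin 3, ∑ j : Fin 3, D i j * (if i = j then p else 0) = (∑ k : Fin 3, D k k) * p := by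
      rw [Finset.sum_mul]
      refine Finset.sum_congr rfl fun i _ => ?_
      rw [Finset.sum_eq_single i (fun j _ hji => by rw [if_neg (Ne.symm hji), mul_zero])
        (fun h => absurd (Finset.mem_univ i) h), if_pos rfl]
    rw [← h2, ← Finset.sum_add_distrib]
    refine Finset.sum_congr rfl fun i _ => ?_
    rw [← Finset.sum_add_distrib]
    refine Finset.sum_congr rfl fun j _ => by ring
  rw [hmid, hfirst]
  have hsplit : ∑ i : Fin 3, ∑ j : Fin 3, D i j * Mmom r w x i j =
      (∑ i : Fin 3, ∑ j : Fin 3, D i j * (momC r w x i * momC r w x j / rhoC r w x)) +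
      ∑ i : Fin 3, ∑ j : Fin 3, D i j * (Mmom r w x i j - momC r w x i * momC r w x j / rhoC r w x) := by
    rw [← Finset.sum_add_distrib]
    refine Finset.sum_congr rfl fun i _ => ?_
    rw [← Finset.sum_add_distrib]
    refine Finset.sum_congr rfl fun j _ => by ring
  rw [hsplit]; ring

/-- The traceless part of a matrix bounded by `C_D` is bounded by `2C_D`. [folklore] -/
theorem abs_traceless_le {D : Fin 3 → Fin 3 → ℝ} {CD : ℝ} (hD : ∀ i j, |D i j| ≤ CD) (i j : Fin 3) :
    |D i j - if i = j then (∑ k : Fin 3, D k k) / 3 else 0| ≤ 2 * CD := by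
  have hC0 : 0 ≤ CD := (abs_nonneg _).trans (hD 0 0)
  have htr : |∑ k : Fin 3, D k k| ≤ 3 * CD := by
    calc _ ≤ ∑ k : Fin 3, |D k k| := Finset.abs_sum_le_sum_abs _ _
      _ ≤ ∑ _k : Fin 3, CD := Finset.sum_le_sum fun k _ => hD k k
      _ = 3 * CD := by simp [Finset.sum_const, Finset.card_univ]
  split_ifs
  · refine (abs_sub _ _).trans ?_
    rw [abs_div, abs_of_pos (by norm_num : (0 : ℝ) < 3)]
    linarith [hD i j]
  · rw [sub_zero]; linarith [hD i j]

/-- The traceless part is traceless. [folklore] -/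
theorem traceless_trace (D : Fin 3 → Fin 3 → ℝ) :
    ∑ i : Fin 3, (D i i - if i = i then (∑ k : Fin 3, D k k) / 3 else 0) = 0 := by
  simp only [if_true, Finset.sum_sub_distrib, Finset.sum_const, Finset.card_univ, Fintype.card_fin]
  simp; ring

/-! ## §4 The registered sub-goal -/

/-- **Registered sub-goal `stub_reductionTransport` (helper of `stub_kineticReduction`): the cone second moments are
dominated by the cone kinetic energy**, `|Mᵢⱼ| ≤ 2 e_r` — the pointwise input making every transport integrand of the
momentum residual kinetically dominated, uniformly in the mollification radius. [folklore] -/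
theorem stub_reductionTransport : ∀ {N : ℕ} {r : ℝ}, 0 < r → ∀ (w : Config (N + 1) (Fin 3) T3) (x : T3) (i j : Fin 3), |Mmom r w x i j| ≤ 2 * kinC r w x :=
  fun hr w x i j => abs_Mmom_le hr w x i j

end Summit.AtomisticToContinuum.HydrodynamicLimit.Theorems.ChaosClosesEulerReduction

end
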